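import Summits.BirchSwinnertonDyer.Rank1Residual.Additive.FormalGroupBallPointsAddII
import Summits.BirchSwinnertonDyer.Rank1Residual.Additive.PadicBallFubini
import Summits.BirchSwinnertonDyer.Rank1Residual.Additive.PadicClosureFormalGroupSeq
import Literature.NumberTheory.EllipticCurves.FormalGroupLogSummableProofs
import Literature.NumberTheory.EllipticCurves.FormalGroupMultiplication
import HarnessLib

/-!
# The logarithm of `E₁(K)` for `K ⊇ ℚ_p` complete: `Λ(P) = log_E(z(P))`, `Λ(nP) = nΛ(P)`,
# **additivity**, tangency, and "`Λ(P) = 0 ⇒ P` is `p`-power torsion" (cell `b2b-bsdres`,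
# CLASS-CLOSURE lane, class O10 — x1b GEN 33, class lead; file 26 of the local series: the
# logarithm `E₁(k_n) → k_n` of [K] §8.4 for the ramified layers `k_n`, AEC IV.6.4 / VII.2.2 beyond
# `ℚ_p`)

HONEST FRAMING (cell `b2b-bsdres`, run/shared/lean/b2b/bsd-rank1-residual/, verbatim in every
file): the goal of the cell is to DELETE the COMBINATION-SHAPED residual classes of the
Birch–Swinnerton-Dyer formula for ALL analytic-rank `≤ 1` elliptic curves over `ℚ` — "full BSD
formula for every rank `≤ 1` curve in class `C`" assembled STRICTLY from published theorems — so
that the rank-`≤ 1` remainder becomes exactly the CONSTRUCTION-SHAPED classes, which are TYPED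
(missing-input `Prop`s), NOT attempted. This is not "finishing BSD". CLASS-CLOSURE lane: prove
what is provable now; shrink each hard class to its core with data; no claim beyond stated classes;
research routes on CONSTRUCTION-SHAPED X12 / O10; census / instrument output = EVIDENCE / conjecture
items, NEVER a Literature fact; `RESIDUAL-MAP.md` marks change only by signed lines. THIS FILE:
TOOL DEFINITIONS + THEOREMS (definitions with bodies: `logQ`, `bLog`, `ptLog`; every statement
proved) — no named Literature fact, no Summits-side fact `def … : Prop`, no `sorry`, axioms
standard; nothing is booked; no label / mark / count / sub-cell moves; O10 stays OPEN /
CONSTRUCTION-SHAPED; nothing about `BSD(W, p)` of any pair is claimed.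

## Content (`M/ℤ_p` with elliptic generic fibre, `K` complete ultrametric normed field over `ℚ_p`,
## `E = curveK p K M`, `E₁(K) = kernel`, `log = formalLog (M ⊗ ℚ_p)`, `‖logₙ‖ ≤ n`)

* §1 `bLog t = ∑ logₙ tⁿ` (`= qEval log t`), **`bLog ([n](t)) = n · bLog t`** (the tree's formal
  identity `log ∘ [n] = n·log` + `qEval_subst`), tangency `‖bLog t − t‖ ≤ B‖t‖²`.
* §2 `z(nP) = [n](z(P))` on `E₁(K)` (`zCoord_nsmul_eq_ev₁_formalMul`, from `zCoord_add_eq_evF`);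
  `ptLog P hP = bLog (z P)`; **`ptLog_nsmul`: `Λ(nP) = nΛ(P)`**.
* §3 **`ptLog_add`: `Λ(P + Q) = Λ(P) + Λ(Q)`** — from `Λ(p^k R) = p^k Λ(R)`, the chart estimate
  `|z(P+Q) − z(P) − z(Q)| ≤ max(|zP|,|zQ|)²`, tangency, and `|z(p^k P)| = |p|^k |z P| → 0`
  (no two-variable rearrangement is needed).
* §4 `ptLog_eq_zero`: `Λ(P) = 0 ⇒ p^k P = 0` for some `k` (tangency at deep level).

References: [SilvermanAEC2009] IV.5–IV.6, VII.2.2; [Kobayashi2003] §8.4 (the logarithm on `E₁(k_n)`).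
-/

noncomputable section

open scoped Classical Topology NNReal
open Filter PowerSeries

namespace Summit.BirchSwinnertonDyer.Rank1Residual.Additive

namespace BallEval

open Literature.NumberTheory.GaloisRepresentations.LubinTate (unitBall mem_unitBall_iff)
open Literature.NumberTheory.EllipticCurves Literature.NumberTheory.EllipticCurves.FormalGroupChart
open WeierstrassCurve

variable (p : ℕ) [hp : Fact p.Prime] (K : Type*) [NontriviallyNormedField K] [NormedAlgebra ℚ_[p] K]
  [IsUltrametricDist K] [CompleteSpace K] (M : WeierstrassCurve ℤ_[p])

/-! ## §1 The series `log` at points of the disc -/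

/-- **The formal logarithm of the generic fibre `M ⊗ ℚ_p`** (`∈ ℚ_p⟦X⟧`, `logₙ = c_{n−1}/n`).
[cite: SilvermanAEC2009, IV.5] -/
def logQ : ℚ_[p]⟦X⟧ := (M.map (PadicInt.Coe.ringHom (p := p))).formalLog

variable {p M} in
/-- **`‖logₙ‖ ≤ n`** (AEC IV.6.3(a); the tree's `norm_coeff_formalLog_le`). [cite: SilvermanAEC2009, IV.6.3] -/
theorem norm_coeff_logQ_le (n : ℕ) : ‖coeff n (logQ p M)‖ ≤ n := by
  haveI := M.isIntegral_map_coe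
  exact (M.map PadicInt.Coe.ringHom).norm_coeff_formalLog_le n

variable {p M} in
/-- `log₁ = 1`. [folklore] -/
theorem coeff_one_logQ : coeff 1 (logQ p M) = 1 := (M.map PadicInt.Coe.ringHom).coeff_one_formalLog

/-- **`bLog t = ∑ₙ logₙ tⁿ ∈ K`**, the logarithm series at `t` (`‖t‖ < 1`). [cite: SilvermanAEC2009, IV.6.4] -/
def bLog (t : K) : K := qEval p K (logQ p M) t

variable {p K M}

/-- **`log([n](t)) = n · log(t)`** at points: the tree's `formalLog_subst_formalMul` for `M ⊗ ℚ_p`,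
evaluated by `qEval_subst`. [cite: SilvermanAEC2009, IV.5] -/
theorem bLog_ev₁_formalMul {t : unitBall K} (ht : ‖(t : K)‖ < 1) (n : ℕ) :
    bLog p K M ((ev₁ p K t (hasEval_of_norm_lt_one ht) (M.formalMul n) : unitBall K) : K) = n * bLog p K M t := by
  haveI := M.isIntegral_map_coe
  have hid : (logQ p M).subst ((M.formalMul n).map (PadicInt.Coe.ringHom (p := p))) = n • logQ p M := by
    have h := (M.map (PadicInt.Coe.ringHom (p := p))).formalLog_subst_formalMul n
    rw [← M.map_formalMul (PadicInt.Coe.ringHom (p := p)) n] at h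
    exact h
  have h := qEval_subst (K := K) (norm_coeff_logQ_le (p := p) (M := M)) (M.constantCoeff_formalMul n) ht
  rw [hid] at h
  rw [bLog, bLog, ← h, qEval, qEval, ← tsum_mul_left]
  refine tsum_congr fun m => ?_
  rw [map_nsmul, nsmul_eq_mul, map_mul, map_natCast, mul_assoc]

/-- **Tangency: `‖log(t) − t‖ ≤ B ‖t‖²`** for `‖t‖ ≤ ρ`, whenever `n ρ^{n−2} ≤ B` for all `n ≥ 2`.
[cite: SilvermanAEC2009, IV.6.3] -/
theorem norm_bLog_sub_le {t : K} (ht : ‖t‖ < 1) {ρ B : ℝ} (hρ : ‖t‖ ≤ ρ) (hB0 : 0 ≤ B)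
    (hB : ∀ n : ℕ, 2 ≤ n → (n : ℝ) * ρ ^ (n - 2) ≤ B) : ‖bLog p K M t - t‖ ≤ ‖t‖ ^ 2 * B := by
  have h := norm_qEval_sub_linear_le (K := K) (norm_coeff_logQ_le (p := p) (M := M)) ht hρ hB0 hB
  rwa [coeff_one_logQ, map_one, one_mul] at h

/-- A usable constant: for `ρ ≤ 1/2`, `n ρ^{n−2} ≤ 2` for all `n ≥ 2`; hence
**`‖log t − t‖ ≤ 2‖t‖²` for `‖t‖ ≤ 1/2`.** [folklore] -/
theorem norm_bLog_sub_le_two {t : K} (ht : ‖t‖ ≤ 1 / 2) : ‖bLog p K M t - t‖ ≤ ‖t‖ ^ 2 * 2 := by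
  have ht1 : ‖t‖ < 1 := ht.trans_lt (by norm_num)
  refine norm_bLog_sub_le ht1 ht zero_le_two fun n hn => ?_
  obtain ⟨k, rfl⟩ := Nat.exists_eq_add_of_le hn
  rw [Nat.add_sub_cancel_left, Nat.cast_add, Nat.cast_two]
  -- `(2 + k) (1/2)^k ≤ 2`, i.e. `2 + k ≤ 2^{k+1}`
  have h2k : (2 + (k : ℝ)) ≤ 2 * 2 ^ k := by
    have : (k : ℝ) + 2 ≤ 2 ^ (k + 1) := by
      have h := Nat.lt_two_pow_self (n := k + 1)
      have h' : (k : ℝ) + 1 + 1 ≤ (2 : ℝ) ^ (k + 1) := by exact_mod_cast h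
      linarith
    rw [pow_succ] at this; linarith
  have hpos : (0 : ℝ) < 2 ^ k := pow_pos two_pos k
  calc (2 + (k : ℝ)) * (1 / 2) ^ k = (2 + k) / 2 ^ k := by rw [one_div, inv_pow, div_eq_mul_inv]
    _ ≤ 2 := by rw [div_le_iff₀ hpos]; exact h2k

/-! ## §2 `Λ(P) = log(z(P))` on `E₁(K)` and `Λ(nP) = nΛ(P)` -/

variable [hE : (M.map PadicInt.Coe.ringHom).IsElliptic]
  [hint : (curveK p K M).IsIntegral (NormedField.valuation (K := K)).integer]

omit hE hint in
/-- `[n+1](t) = F([n](t), t)` at points. [cite: SilvermanAEC2009, IV.2] -/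
theorem coe_ev₁_formalMul_succ {t : unitBall K} (ht : ‖(t : K)‖ < 1) (n : ℕ) :
    ((ev₁ p K t (hasEval_of_norm_lt_one ht) (M.formalMul (n + 1)) : unitBall K) : K) =
      (evF p M (ev₁ p K t (hasEval_of_norm_lt_one ht) (M.formalMul n)) t (norm_ev₁_formalMul_lt_one ht n) ht : K) := by
  have hX' : ‖((ev₁ p K t (hasEval_of_norm_lt_one ht) PowerSeries.X : unitBall K) : K)‖ < 1 := by
    rw [ev₁_X]; exact ht
  rw [M.formalMul_succ, coe_ev₁_substPair ht (M.constantCoeff_formalMul n) PowerSeries.constantCoeff_X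
    (norm_ev₁_formalMul_lt_one ht n) hX', ev_apply, evF, ev_apply]
  have e : (![ev₁ p K t (hasEval_of_norm_lt_one ht) (M.formalMul n), t] : Fin 2 → unitBall K) =
      ![ev₁ p K t (hasEval_of_norm_lt_one ht) (M.formalMul n), ev₁ p K t (hasEval_of_norm_lt_one ht) PowerSeries.X] := by
    funext i; fin_cases i <;> simp [ev₁_X]
  rw [e]

/-- **`z(nP) = [n](z(P))`** for `P ∈ E₁(K)` (induction on `n` with `zCoord_add_eq_evF` and
`[n+1] = F([n], X)`). [cite: SilvermanAEC2009, Prop. VII.2.2] -/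
theorem zCoord_nsmul_eq_ev₁_formalMul {P : (curveK p K M).toAffine.Point}
    (hP : P ∈ kernel (NormedField.valuation (K := K)) (curveK p K M)) (n : ℕ) :
    (n • P).zCoord = ((ev₁ p K (zBall P hP) (hasEval_of_norm_lt_one (norm_zBall_lt_one hP)) (M.formalMul n) :
      unitBall K) : K) := by
  induction n with
  | zero => rw [zero_nsmul, Affine.Point.zCoord_zero, M.formalMul_zero, map_zero, Subring.coe_zero]
  | succ n ih =>
    have hnP : n • P ∈ kernel (NormedField.valuation (K := K)) (curveK p K M) := (kernel (NormedField.valuation (K := K)) (curveK p K M)).nsmul_mem hP n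
    rw [succ_nsmul, zCoord_add_eq_evF hnP hP, coe_ev₁_formalMul_succ (norm_zBall_lt_one hP)]
    congr 2
    exact Subtype.ext ih

variable (p K M) in
/-- **`Λ(P) = log(z(P))`**, the logarithm on `E₁(K)`. [cite: Kobayashi2003, §8.4] -/
def ptLog (P : (curveK p K M).toAffine.Point) : K := bLog p K M P.zCoord

omit [CompleteSpace K] hE hint in
/-- `Λ(O) = 0`. [folklore] -/
theorem ptLog_zero : ptLog p K M 0 = 0 := by
  rw [ptLog, Affine.Point.zCoord_zero, bLog, qEval_zero (norm_coeff_logQ_le (p := p) (M := M))]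

/-- **`Λ(nP) = n Λ(P)`** on `E₁(K)`. [cite: SilvermanAEC2009, IV.6.4] -/
theorem ptLog_nsmul {P : (curveK p K M).toAffine.Point}
    (hP : P ∈ kernel (NormedField.valuation (K := K)) (curveK p K M)) (n : ℕ) :
    ptLog p K M (n • P) = n * ptLog p K M P := by
  rw [ptLog, ptLog, zCoord_nsmul_eq_ev₁_formalMul hP n, bLog_ev₁_formalMul (norm_zBall_lt_one hP) n]
  rfl

/-! ## §3 Additivity -/

omit [CompleteSpace K] hE in
/-- `‖z(p^k • P)‖ = ‖p‖^k ‖z(P)‖` at deep level (`‖z P‖ < ‖p‖`; the tree's chart estimate). [folklore] -/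
theorem norm_zCoord_pow_smul_eq {P : (curveK p K M).toAffine.Point}
    (hP : P ∈ kernel (NormedField.valuation (K := K)) (curveK p K M)) (hlt : ‖P.zCoord‖ < ‖(p : K)‖) (k : ℕ) :
    ‖(p ^ k • P).zCoord‖ = ‖(p : K)‖ ^ k * ‖P.zCoord‖ := by
  have h := val_zCoord_pow_smul_eq_of_lt (w := NormedField.valuation (K := K)) p hP
    (by simpa [← NNReal.coe_lt_coe, NormedField.valuation_apply] using hlt) k
  have h' := congrArg (fun x : ℝ≥0 => (x : ℝ)) h
  simpa [NormedField.valuation_apply] using h'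

omit [CompleteSpace K] hE in
/-- `‖z(p^k • P)‖ ≤ ‖z(P)‖` and `→ 0`: precisely `‖z(p^k P)‖ ≤ max(‖p‖, ‖zP‖)^k ‖zP‖`. [folklore] -/
theorem norm_zCoord_pow_smul_le {P : (curveK p K M).toAffine.Point}
    (hP : P ∈ kernel (NormedField.valuation (K := K)) (curveK p K M)) (k : ℕ) :
    ‖(p ^ k • P).zCoord‖ ≤ max ‖(p : K)‖ ‖P.zCoord‖ ^ k * ‖P.zCoord‖ := by
  have h := val_zCoord_pow_smul_le (w := NormedField.valuation (K := K)) p hP k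
  have h' : ((NormedField.valuation (K := K) (p ^ k • P).zCoord : ℝ≥0) : ℝ) ≤
      ((max (NormedField.valuation (K := K) (p : K)) (NormedField.valuation (K := K) P.zCoord) ^ k *
        NormedField.valuation (K := K) P.zCoord : ℝ≥0) : ℝ) := by exact_mod_cast h
  simpa [NormedField.valuation_apply, NNReal.coe_max] using h'

omit [IsUltrametricDist K] [CompleteSpace K] hE hint in
/-- `0 < ‖p‖ < 1` in `K`. [folklore] -/
theorem norm_p_pos_lt : 0 < ‖(p : K)‖ ∧ ‖(p : K)‖ < 1 := by
  have h : (p : K) = algebraMap ℚ_[p] K (p : ℚ_[p]) := by rw [map_natCast]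
  rw [h, norm_algebraMap_padic, Padic.norm_p]
  have h1 : (1 : ℝ) < p := by exact_mod_cast hp.out.one_lt
  exact ⟨inv_pos.mpr (by linarith), inv_lt_one_of_one_lt₀ h1⟩

/-- The additivity defect `h(P, Q) = Λ(P+Q) − Λ(P) − Λ(Q)` scales: `h(p^k P, p^k Q) = p^k h(P, Q)`. [folklore] -/
theorem ptLog_defect_smul {P Q : (curveK p K M).toAffine.Point}
    (hP : P ∈ kernel (NormedField.valuation (K := K)) (curveK p K M))
    (hQ : Q ∈ kernel (NormedField.valuation (K := K)) (curveK p K M)) (k : ℕ) :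
    ptLog p K M (p ^ k • P + p ^ k • Q) - ptLog p K M (p ^ k • P) - ptLog p K M (p ^ k • Q) =
      (p : K) ^ k * (ptLog p K M (P + Q) - ptLog p K M P - ptLog p K M Q) := by
  rw [← smul_add, ptLog_nsmul ((kernel (NormedField.valuation (K := K)) (curveK p K M)).add_mem hP hQ), ptLog_nsmul hP, ptLog_nsmul hQ]
  push_cast
  ring

omit hE in
/-- The defect is quadratically small at deep level: if `‖zP‖, ‖zQ‖ ≤ r ≤ 1/2` then
`‖Λ(P+Q) − Λ(P) − Λ(Q)‖ ≤ 2 r²`. [cite: SilvermanAEC2009, IV.6.3] -/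
theorem norm_ptLog_defect_le {P Q : (curveK p K M).toAffine.Point}
    (hP : P ∈ kernel (NormedField.valuation (K := K)) (curveK p K M))
    (hQ : Q ∈ kernel (NormedField.valuation (K := K)) (curveK p K M)) {r : ℝ}
    (hPr : ‖P.zCoord‖ ≤ r) (hQr : ‖Q.zCoord‖ ≤ r) (hr : r ≤ 1 / 2) :
    ‖ptLog p K M (P + Q) - ptLog p K M P - ptLog p K M Q‖ ≤ r ^ 2 * 2 := by
  have hr0 : 0 ≤ r := (norm_nonneg _).trans hPr
  -- `‖z(P+Q)‖ ≤ r` and `‖z(P+Q) − zP − zQ‖ ≤ r²`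
  have hPQ : ‖(P + Q).zCoord‖ ≤ r := by
    have h := val_zCoord_add_le (w := NormedField.valuation (K := K)) hP hQ
    have h' : ((NormedField.valuation (K := K) (P + Q).zCoord : ℝ≥0) : ℝ) ≤
        ((max (NormedField.valuation (K := K) P.zCoord) (NormedField.valuation (K := K) Q.zCoord) : ℝ≥0) : ℝ) := by
      exact_mod_cast h
    simp only [NormedField.valuation_apply, NNReal.coe_max, coe_nnnorm] at h'
    exact h'.trans (max_le hPr hQr)
  have hsub : ‖(P + Q).zCoord - P.zCoord - Q.zCoord‖ ≤ r ^ 2 := by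
    have h := val_zCoord_add_sub_le (w := NormedField.valuation (K := K)) hP hQ
    have h' : ((NormedField.valuation (K := K) ((P + Q).zCoord - P.zCoord - Q.zCoord) : ℝ≥0) : ℝ) ≤
        ((max (NormedField.valuation (K := K) P.zCoord) (NormedField.valuation (K := K) Q.zCoord) ^ 2 : ℝ≥0) : ℝ) := by
      exact_mod_cast h
    simp only [NormedField.valuation_apply, NNReal.coe_pow, NNReal.coe_max, coe_nnnorm] at h'
    exact h'.trans (pow_le_pow_left₀ (le_max_of_le_left (norm_nonneg _)) (max_le hPr hQr) 2)
  have e : ptLog p K M (P + Q) - ptLog p K M P - ptLog p K M Q =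
      (bLog p K M (P + Q).zCoord - (P + Q).zCoord) - (bLog p K M P.zCoord - P.zCoord) -
        (bLog p K M Q.zCoord - Q.zCoord) + ((P + Q).zCoord - P.zCoord - Q.zCoord) := by
    simp only [ptLog]; ring
  rw [e]
  have b1 := norm_bLog_sub_le_two (p := p) (K := K) (M := M) (hPQ.trans hr)
  have b2 := norm_bLog_sub_le_two (p := p) (K := K) (M := M) (hPr.trans hr)
  have b3 := norm_bLog_sub_le_two (p := p) (K := K) (M := M) (hQr.trans hr)
  have hb : ∀ {x : K}, ‖x‖ ≤ r → ‖x‖ ^ 2 * 2 ≤ r ^ 2 * 2 := fun hx =>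
    mul_le_mul_of_nonneg_right (pow_le_pow_left₀ (norm_nonneg _) hx 2) zero_le_two
  have hr2 : r ^ 2 ≤ r ^ 2 * 2 := le_mul_of_one_le_right (sq_nonneg r) one_le_two
  refine (IsUltrametricDist.norm_add_le_max _ _).trans (max_le ?_ (hsub.trans hr2))
  rw [sub_eq_add_neg, sub_eq_add_neg]
  refine (IsUltrametricDist.norm_add_le_max _ _).trans (max_le ?_ ?_)
  · refine (IsUltrametricDist.norm_add_le_max _ _).trans (max_le (b1.trans (hb hPQ)) ?_)
    rw [norm_neg]; exact b2.trans (hb hPr)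
  · rw [norm_neg]; exact b3.trans (hb hQr)

/-- **Additivity of the logarithm on `E₁(K)`: `Λ(P + Q) = Λ(P) + Λ(Q)`** (`K ⊇ ℚ_p` complete
ultrametric): the defect `h` satisfies `h(P,Q) = h(p^kP, p^kQ)/p^k` and, at deep level,
`‖h(p^kP, p^kQ)‖ ≤ 2 (‖p‖^k c)²`, so `‖h(P,Q)‖ ≤ 2c²‖p‖^k → 0`. [cite: SilvermanAEC2009, IV.6.4] -/
theorem ptLog_add {P Q : (curveK p K M).toAffine.Point}
    (hP : P ∈ kernel (NormedField.valuation (K := K)) (curveK p K M))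
    (hQ : Q ∈ kernel (NormedField.valuation (K := K)) (curveK p K M)) :
    ptLog p K M (P + Q) = ptLog p K M P + ptLog p K M Q := by
  obtain ⟨hp0, hp1⟩ := norm_p_pos_lt (p := p) (K := K)
  -- Step 1: push both points to deep level `‖z‖ < ‖p‖/2 ≤ …` by a power of `p`.
  set r₀ := max ‖(p : K)‖ (max ‖P.zCoord‖ ‖Q.zCoord‖) with hr₀
  have hr₀1 : r₀ < 1 := max_lt hp1 (max_lt (norm_zCoord_lt_one hP) (norm_zCoord_lt_one hQ))
  have hr₀0 : 0 ≤ r₀ := le_max_of_le_left (norm_nonneg _)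
  set c := ‖(p : K)‖ / 2 with hc
  have hc0 : 0 < c := half_pos hp0
  obtain ⟨j, hj⟩ : ∃ j : ℕ, r₀ ^ j < c := exists_pow_lt_of_lt_one hc0 hr₀1
  have hdeep : ∀ {R : (curveK p K M).toAffine.Point},
      R ∈ kernel (NormedField.valuation (K := K)) (curveK p K M) → ‖R.zCoord‖ ≤ max ‖P.zCoord‖ ‖Q.zCoord‖ →
      ‖(p ^ j • R).zCoord‖ < c := by
    intro R hR hRle
    refine (norm_zCoord_pow_smul_le hR j).trans_lt ?_
    have hR1 : ‖R.zCoord‖ ≤ 1 := (norm_zCoord_lt_one hR).le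
    have hm : max ‖(p : K)‖ ‖R.zCoord‖ ≤ r₀ := max_le (le_max_left _ _) (hRle.trans (le_max_right _ _))
    calc max ‖(p : K)‖ ‖R.zCoord‖ ^ j * ‖R.zCoord‖ ≤ r₀ ^ j * 1 :=
          mul_le_mul (pow_le_pow_left₀ (le_max_of_le_left (norm_nonneg _)) hm j) hR1 (norm_nonneg _)
            (pow_nonneg hr₀0 _)
      _ < c := by rw [mul_one]; exact hj
  set P' := p ^ j • P with hP'
  set Q' := p ^ j • Q with hQ'
  have hP'm : P' ∈ kernel (NormedField.valuation (K := K)) (curveK p K M) := (kernel (NormedField.valuation (K := K)) (curveK p K M)).nsmul_mem hP _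
  have hQ'm : Q' ∈ kernel (NormedField.valuation (K := K)) (curveK p K M) := (kernel (NormedField.valuation (K := K)) (curveK p K M)).nsmul_mem hQ _
  have hP'c : ‖P'.zCoord‖ < c := hdeep hP (le_max_left _ _)
  have hQ'c : ‖Q'.zCoord‖ < c := hdeep hQ (le_max_right _ _)
  -- Step 2: the defect of `(P', Q')` vanishes.
  have hdef' : ptLog p K M (P' + Q') - ptLog p K M P' - ptLog p K M Q' = 0 := by
    set d := ptLog p K M (P' + Q') - ptLog p K M P' - ptLog p K M Q' with hd
    by_contra hne
    have hdpos : 0 < ‖d‖ := norm_pos_iff.mpr hne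
    -- for every k: ‖p‖^k ‖d‖ ≤ 2 (‖p‖^k c)²  ⇒  ‖d‖ ≤ 2 c² ‖p‖^k
    have hk : ∀ k : ℕ, ‖d‖ ≤ 2 * c ^ 2 * ‖(p : K)‖ ^ k := by
      intro k
      have hpk : 0 < ‖(p : K)‖ ^ k := pow_pos hp0 k
      have e := ptLog_defect_smul hP'm hQ'm k
      have hPk : ‖(p ^ k • P').zCoord‖ ≤ ‖(p : K)‖ ^ k * c := by
        rw [norm_zCoord_pow_smul_eq hP'm (hP'c.trans_le (by rw [hc]; linarith))]
        exact mul_le_mul_of_nonneg_left hP'c.le hpk.le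
      have hQk : ‖(p ^ k • Q').zCoord‖ ≤ ‖(p : K)‖ ^ k * c := by
        rw [norm_zCoord_pow_smul_eq hQ'm (hQ'c.trans_le (by rw [hc]; linarith))]
        exact mul_le_mul_of_nonneg_left hQ'c.le hpk.le
      have hrk : ‖(p : K)‖ ^ k * c ≤ 1 / 2 := by
        have : ‖(p : K)‖ ^ k ≤ 1 := pow_le_one₀ hp0.le hp1.le
        calc ‖(p : K)‖ ^ k * c ≤ 1 * c := mul_le_mul_of_nonneg_right this hc0.le
          _ ≤ 1 / 2 := by rw [one_mul, hc]; linarith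
      have hb := norm_ptLog_defect_le ((kernel (NormedField.valuation (K := K)) (curveK p K M)).nsmul_mem hP'm _) ((kernel (NormedField.valuation (K := K)) (curveK p K M)).nsmul_mem hQ'm _) hPk hQk hrk
      rw [e, norm_mul, norm_pow] at hb
      refine le_of_mul_le_mul_left ?_ hpk
      calc ‖(p : K)‖ ^ k * ‖d‖ ≤ (‖(p : K)‖ ^ k * c) ^ 2 * 2 := hb
        _ = ‖(p : K)‖ ^ k * (2 * c ^ 2 * ‖(p : K)‖ ^ k) := by ring
    obtain ⟨k, hk'⟩ : ∃ k : ℕ, ‖(p : K)‖ ^ k < ‖d‖ / (2 * c ^ 2) :=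
      exists_pow_lt_of_lt_one (div_pos hdpos (by positivity)) hp1
    have := hk k
    rw [lt_div_iff₀ (by positivity)] at hk'
    linarith
  -- Step 3: descend.
  have e := ptLog_defect_smul hP hQ j
  rw [← hP', ← hQ', hdef'] at e
  have hpj : (p : K) ^ j ≠ 0 := pow_ne_zero j (norm_pos_iff.mp hp0)
  have := (mul_eq_zero.mp e.symm).resolve_left hpj
  linear_combination this

/-! ## §4 `Λ(P) = 0` only on `p`-power torsion -/

omit hE hint in
/-- At deep level the logarithm is an isometry: `‖Λ(P)‖ = ‖z(P)‖` for `‖zP‖ < 1/2`. [folklore] -/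
theorem norm_ptLog_eq {P : (curveK p K M).toAffine.Point} (hlt : ‖P.zCoord‖ < 1 / 2) :
    ‖ptLog p K M P‖ = ‖P.zCoord‖ := by
  by_cases h0 : P.zCoord = 0
  · rw [ptLog, h0, bLog, qEval_zero (norm_coeff_logQ_le (p := p) (M := M)), norm_zero]
  have hb := norm_bLog_sub_le_two (p := p) (K := K) (M := M) hlt.le
  have hpos : 0 < ‖P.zCoord‖ := norm_pos_iff.mpr h0
  have hlt' : ‖bLog p K M P.zCoord - P.zCoord‖ < ‖P.zCoord‖ := by
    refine hb.trans_lt ?_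
    calc ‖P.zCoord‖ ^ 2 * 2 = ‖P.zCoord‖ * (‖P.zCoord‖ * 2) := by ring
      _ < ‖P.zCoord‖ * 1 := by
          refine mul_lt_mul_of_pos_left ?_ hpos
          linarith
      _ = ‖P.zCoord‖ := mul_one _
  rw [ptLog]
  have e : bLog p K M P.zCoord = (bLog p K M P.zCoord - P.zCoord) + P.zCoord := by ring
  rw [e, IsUltrametricDist.norm_add_eq_max_of_norm_ne_norm (ne_of_lt hlt'), max_eq_right hlt'.le]

/-- **`Λ(P) = 0 ⇒ p^k • P = 0` for some `k`.** [cite: SilvermanAEC2009, IV.6.4] -/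
theorem exists_pow_smul_eq_zero_of_ptLog_eq_zero {P : (curveK p K M).toAffine.Point}
    (hP : P ∈ kernel (NormedField.valuation (K := K)) (curveK p K M)) (h0 : ptLog p K M P = 0) :
    ∃ k : ℕ, p ^ k • P = 0 := by
  obtain ⟨hp0, hp1⟩ := norm_p_pos_lt (p := p) (K := K)
  set r₀ := max ‖(p : K)‖ ‖P.zCoord‖ with hr₀
  have hr₀1 : r₀ < 1 := max_lt hp1 (norm_zCoord_lt_one hP)
  obtain ⟨k, hk⟩ : ∃ k : ℕ, r₀ ^ k < 1 / 2 := exists_pow_lt_of_lt_one (by norm_num) hr₀1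
  refine ⟨k, ?_⟩
  have hPk : p ^ k • P ∈ kernel (NormedField.valuation (K := K)) (curveK p K M) := (kernel (NormedField.valuation (K := K)) (curveK p K M)).nsmul_mem hP _
  have hlt : ‖(p ^ k • P).zCoord‖ < 1 / 2 := by
    refine (norm_zCoord_pow_smul_le hP k).trans_lt ?_
    calc max ‖(p : K)‖ ‖P.zCoord‖ ^ k * ‖P.zCoord‖ ≤ r₀ ^ k * 1 :=
          mul_le_mul le_rfl (norm_zCoord_lt_one hP).le (norm_nonneg _) (pow_nonneg (le_max_of_le_left (norm_nonneg _)) _)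
      _ < 1 / 2 := by rw [mul_one]; exact hk
  have hL : ptLog p K M (p ^ k • P) = 0 := by rw [ptLog_nsmul hP, h0, mul_zero]
  have hz : ‖(p ^ k • P).zCoord‖ = 0 := by rw [← norm_ptLog_eq hlt, hL, norm_zero]
  exact (zCoord_eq_zero_iff hPk).mp (norm_eq_zero.mp hz)

end BallEval

end Summit.BirchSwinnertonDyer.Rank1Residual.Additive

end
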